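import Literature.AlgebraicGeometry.AbelianSchemes.SerreTensorIsogeny
import HarnessLib

/-!
# The ideal translation `ψ_P : A ⟶ A ⊗_𝒪 𝔟` («`A ⟶ A ⊗_𝒪 𝔭⁻¹`») and its kernel `A[𝔭]`

Topic `AlgebraicGeometry/AbelianSchemes`, namespace `Literature.AlgebraicGeometry.AbelianSchemes.AbelianSchemeOver` (one construction with
body + proved theorems; no named fact, no `sorry`, no `instance`, no notation; ANY base scheme `S`, any commutative coefficient ring `𝒪`,
any characteristic).  Cell `hodgecm-mathlib`, F0/P6 «MOD», P6a organ (g2) SERRE TENSOR, follow-up FILE «(A) KERNEL OF THE SERRE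
ISOGENY» (desk F0P6c-plan (g0) «= (A)» 2026-09-01T15:15:39Z) over ★ FILE 15 `SerreTensorIsogeny` and ★ FILES 2∕5∕7
(`SerreTensorConstruction`, `SerreTensorPresentation`, `SerreTensorModuleMap`); `--supports stmt-HodgeConjecture-24832`, count-neutral.
HC_CM is proved only modulo the 2 remaining named inputs (hLiu418, h413) until rung 0 closes; this file discharges none of them.

## Mathematics

Let `act : 𝒪 → End(A)` be a ring action on the commutative abelian scheme `A ∕ S`, `𝔟 = E′·𝒪ᵐ` a presented finitely generated
projective `𝒪`-module (`E′² = E′`) and `P ∈ 𝔟 ⊆ 𝒪ᵐ` an element (a column with `E′P = P`).  The module map `𝒪 → 𝔟, 1 ↦ P` induces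
(★ `serrePresentationHom` for the presentations `𝒪 = 1·𝒪¹`, `𝔟 = E′·𝒪ᵐ`, composed with ★ `A ≅ A ⊗_𝒪 𝒪`) the homomorphism

  `ψ_P : A ⟶ A ⊗_𝒪 𝔟`,   on points `y ↦ (y ≫ ι(P_k))_k = «y ⊗ P»`.

THE KERNEL: `y ≫ ψ_P = 1 ↔ ∀ k, ι(P_k) y = 1 ↔ ∀ a ∈ 𝔭, ι(a) y = 1` where `𝔭 = (P_1, …, P_m) ⊆ 𝒪` is the ideal generated by
the coordinates of `P` — i.e. **`Ker ψ_P = A[𝔭]`** on `T`-valued points for every `S`-scheme `T`.  MODEL CASE: `𝔟 ≅ 𝔭⁻¹` for an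
invertible ideal `𝔭` of a Dedekind ring and `P ↔ 1 ∈ 𝔭⁻¹`; then the coordinate functionals of the direct summand `𝔟 ⊆ 𝒪ᵐ` restrict
to generators of `Hom_𝒪(𝔭⁻¹, 𝒪) = 𝔭`, so the coordinates of `1` generate exactly `𝔭`, and `ψ_P` is «`A ⟶ A ⊗_𝒪 𝔭⁻¹`» with kernel
the `𝔭`-torsion `A[𝔭]` (B. Conrad, *Gross–Zagier revisited* §7, Thm. 7.5 and the discussion of `𝒪_K ⟶ 𝔞⁻¹`; J. Milne, *Complex
multiplication* §7 «𝔞-multiplications»: `A ⟶ A^𝔞 = A ⊗ 𝔞⁻¹` is the quotient by `A[𝔞]`).  With a quasi-inverse `Q ∈ M_{1×m}(𝒪)`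
(`QE′ = Q`, `QP = N`, `PQ = N·E′`, `N ≠ 0` — e.g. multiplication by an integer `N ∈ 𝔭` on `𝔭⁻¹`) ★ FILE 15 makes `ψ_P` FINITE, FLAT
and SURJECTIVE: **`A ⊗_𝒪 𝔭⁻¹` is the quotient of `A` by `A[𝔭]`**, in the recognition shape consumed by ★
`AbelianSchemeHomDescentFlatSurjective.exists_iso_comp_eq_of_forall_comp_eq_one` («an isogeny out of `A` killing exactly `A[𝔭]`, of the
same degree, IS `ψ_P`»).  PRINCIPAL CASE `m = 1`, `E′ = 1`, `P = (a)`: `ψ_{(a)} = ι(a) ≫ (A ≅ A ⊗_𝒪 𝒪)` — translation by a principal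
ideal is multiplication.

## Contents

* §0 `serreHomEquiv_one_coe`, `eq_one_iff_serreHomEquiv` (a point of `A ⊗_𝒪 𝔟` is `1` iff all its coordinates are);
* §1 **`serreTranslate act E′ hE′ P : A.X ⟶ (serreTensor act E′ hE′).X`**, `isMonHom_serreTranslate`,
  `serreHomEquiv_comp_serreTensorOneIso_inv`, **`serreHomEquiv_comp_serreTranslate`** (coordinates `y ≫ ι(P_k)`),
  `i_comp_serreTranslate` (`𝒪`-equivariance);
* §2 `comp_i_eq_one_of_mem_span`, `forall_comp_i_eq_one_iff_of_span_eq` (the annihilator of a point is an ideal),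
  **`comp_serreTranslate_eq_one_iff`**, **`comp_serreTranslate_eq_one_iff_forall_mem`** (`Ker ψ_P = A[𝔭]` on points),
  `comp_serreTranslate_eq_one_of_forall_mem` (the «kills `A[𝔭]`» direction as consumed by descent);
* §3 **`isFinite_serreTranslate_left`**, **`flat_serreTranslate_left`**, **`surjective_serreTranslate_left`** (quasi-inverse `Q`, `N ≠ 0`);
* §4 `smul_one_fin_one_apply`, **`serreTranslate_smul_one`** (`ψ_{(a)} = ι(a) ≫ (A ≅ A ⊗ 𝒪)`), `comp_serreTranslate_smul_one_eq_one_iff`.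

## References
* [Conrad2004GrossZagier] B. Conrad, *Gross–Zagier revisited*, MSRI Publ. 49 (2004), §7 «The Serre tensor construction», Thm. 7.5.
* [MilneCM2006] J. S. Milne, *Complex Multiplication* (2006), §7 «𝔞-multiplications» (the isogeny `λ^𝔞 : A → A^𝔞` with kernel `A[𝔞]`).
* [MumfordAV1970] D. Mumford, *Abelian Varieties*, §7 Thm. 4 (p. 72) (isogenies ↔ finite subgroups; the recognition consumer).
* Tree: ★ `AbelianSchemes/SerreTensorIsogeny` (FILE 15) and its imports; consumer shape ★ `AbelianSchemes/AbelianSchemeHomDescentFlatSurjective`.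
-/

noncomputable section

universe u

open CategoryTheory CategoryTheory.Limits AlgebraicGeometry MonoidalCategory CartesianMonoidalCategory
open scoped MonObj

namespace Literature.AlgebraicGeometry.AbelianSchemes

namespace AbelianSchemeOver

variable {S : Scheme.{u}} {A : AbelianSchemeOver S} {O : Type*} [CommRing O] (act : A.RingAction O) [IsCommMonObj A.X]

/-! ## §0 Points of `A ⊗_𝒪 𝔟`: the unit, and detection of `t = 1` by coordinates -/

section Points

variable {n : ℕ} (E : Matrix (Fin n) (Fin n) O) (hE : E * E = E)

/-- The coordinates of the unit point of `A ⊗_𝒪 𝔟` are the unit: `(1 ≫ ι ≫ pr_k) = 1`. [cite: Conrad2004GrossZagier, §7] -/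
theorem serreHomEquiv_one_coe {T : Over S} (k : Fin n) :
    (serreHomEquiv act E hE T (1 : T ⟶ (serreTensor act E hE).X) : Fin n → (T ⟶ A.X)) k = 1 := by
  haveI := (isMonHom_serreι_serreπ act E hE).1
  haveI := A.isMonHom_powProj n k
  rw [serreHomEquiv_apply_coe, MonObj.one_comp, MonObj.one_comp]

/-- A point `t` of `A ⊗_𝒪 𝔟` is the unit iff all its coordinates `t ≫ ι ≫ pr_k` are. [cite: Conrad2004GrossZagier, §7] -/
theorem eq_one_iff_serreHomEquiv {T : Over S} (t : T ⟶ (serreTensor act E hE).X) :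
    t = 1 ↔ ∀ k, (serreHomEquiv act E hE T t : Fin n → (T ⟶ A.X)) k = 1 := by
  refine ⟨fun h k => by rw [h, serreHomEquiv_one_coe], fun h => (serreHomEquiv act E hE T).injective (Subtype.ext (funext fun k => ?_))⟩
  rw [h k, serreHomEquiv_one_coe]

end Points

/-! ## §1 The ideal translation `ψ_P : A ⟶ A ⊗_𝒪 𝔟` of an element `P ∈ 𝔟 = E′·𝒪ᵐ` -/

section Translate

variable {m : ℕ} (E' : Matrix (Fin m) (Fin m) O) (hE' : E' * E' = E') (P : Matrix (Fin m) (Fin 1) O)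

/-- **The ideal translation `ψ_P : A ⟶ A ⊗_𝒪 𝔟`** of a column `P ∈ M_{m×1}(𝒪)` (an element of `𝔟 = E′·𝒪ᵐ` when `E′P = P`): the
Serre map of the module map `𝒪 → 𝔟, 1 ↦ P` precomposed with `A ≅ A ⊗_𝒪 𝒪` (★ `serreTensorOneIso`).  For `𝔟 ≅ 𝔭⁻¹`, `P ↔ 1`, this
is «`A ⟶ A ⊗_𝒪 𝔭⁻¹`». [cite: Conrad2004GrossZagier, §7 (Thm. 7.5)] [cite: MilneCM2006, §7] -/
def serreTranslate : A.X ⟶ (serreTensor act E' hE').X :=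
  (serreTensorOneIso act).inv ≫ serrePresentationHom act (1 : Matrix (Fin 1) (Fin 1) O) one_mul_one_fin_one E' hE' P

/-- `ψ_P` is a homomorphism of `S`-group schemes. [cite: Conrad2004GrossZagier, §7 (Thm. 7.5)] -/
theorem isMonHom_serreTranslate : IsMonHom (serreTranslate act E' hE' P) := by
  haveI := (isMonHom_serreTensorOneIso act).2
  haveI := isMonHom_serrePresentationHom act (1 : Matrix (Fin 1) (Fin 1) O) one_mul_one_fin_one E' hE' P
  unfold serreTranslate
  infer_instance

/-- The point `y` of `A`, read in `A ⊗_𝒪 𝒪 = Fix(𝟙 ↷ A¹)`, has the single coordinate `y`. [cite: Conrad2004GrossZagier, §7] -/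
theorem serreHomEquiv_comp_serreTensorOneIso_inv {T : Over S} (y : T ⟶ A.X) (k : Fin 1) :
    (serreHomEquiv act (1 : Matrix (Fin 1) (Fin 1) O) one_mul_one_fin_one T (y ≫ (serreTensorOneIso act).inv) :
      Fin 1 → (T ⟶ A.X)) k = y := by
  rw [Fin.fin_one_eq_zero k, serreHomEquiv_apply_coe, Category.assoc]
  change y ≫ (serreTensorOneIso act).inv ≫ (serreTensorOneIso act).hom = y
  rw [Iso.inv_hom_id, Category.comp_id]

/-- **`ψ_P` on points**: the `k`-th coordinate of `ψ_P(y)` is `y ≫ ι(P_k)` («`y ⊗ P = (P_k · y)_k`»). [cite: Conrad2004GrossZagier, §7 (Thm. 7.5)] -/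
theorem serreHomEquiv_comp_serreTranslate (hP : E' * P = P) {T : Over S} (y : T ⟶ A.X) (k : Fin m) :
    (serreHomEquiv act E' hE' T (y ≫ serreTranslate act E' hE' P) : Fin m → (T ⟶ A.X)) k = y ≫ act.i (P k 0) := by
  have h := congrFun (serreHomEquiv_serrePresentationHom act (1 : Matrix (Fin 1) (Fin 1) O) one_mul_one_fin_one E' hE' P
    (by rw [Matrix.mul_one]; exact hP) (y ≫ (serreTensorOneIso act).inv)) k
  rw [serreTranslate, ← Category.assoc, h]
  unfold matrixCompRect
  rw [Fin.prod_univ_one, serreHomEquiv_comp_serreTensorOneIso_inv]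

/-- **`𝒪`-equivariance of `ψ_P`**: `ι(a) ≫ ψ_P = ψ_P ≫ ι_{A ⊗ 𝔟}(a)`. [cite: Conrad2004GrossZagier, §7 (Thm. 7.5)] -/
theorem i_comp_serreTranslate (hP : E' * P = P) (a : O) :
    act.i a ≫ serreTranslate act E' hE' P = serreTranslate act E' hE' P ≫ (serreAction act E' hE').i a := by
  have h1 : act.i a ≫ (serreTensorOneIso act).inv =
      (serreTensorOneIso act).inv ≫ (serreAction act (1 : Matrix (Fin 1) (Fin 1) O) one_mul_one_fin_one).i a := by
    rw [Iso.eq_inv_comp, ← Category.assoc, ← serreTensorOneIso_equivariant, Category.assoc, Iso.hom_inv_id, Category.comp_id]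
  rw [serreTranslate, ← Category.assoc, h1, Category.assoc,
    serreAction_comp_serrePresentationHom_of act (1 : Matrix (Fin 1) (Fin 1) O) one_mul_one_fin_one E' hE' P
      (by rw [Matrix.mul_one]; exact hP), Category.assoc]

end Translate

/-! ## §2 The kernel of `ψ_P` is the `𝔭`-torsion `A[𝔭]`, `𝔭 = (P_1, …, P_m)` -/

section Kernel

/-- **The annihilator of a point is an ideal**: if `ι(a) y = 1` for all `a ∈ s` then `ι(a) y = 1` for all `a` in the ideal generated by
`s` (`ι(a+b) y = ι(a) y · ι(b) y`, `ι(ca) y = ι(c)(ι(a) y)`, `ι(0) y = 1`). [cite: MilneCM2006, §7] -/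
theorem comp_i_eq_one_of_mem_span {T : Over S} (y : T ⟶ A.X) {s : Set O} (hs : ∀ a ∈ s, y ≫ act.i a = 1) {a : O}
    (ha : a ∈ Ideal.span s) : y ≫ act.i a = 1 := by
  refine Submodule.span_induction (p := fun b _ => y ≫ act.i b = 1) (fun b hb => hs b hb) (act.comp_i_zero_one y).1
    (fun b c _ _ hb hc => ?_) (fun c b _ hb => ?_) ha
  · rw [act.comp_i_add, hb, hc, mul_one]
  · haveI := act.isMonHom c
    rw [smul_eq_mul, act.comp_i_mul, hb, MonObj.one_comp]

/-- For a family `v` generating the ideal `𝔭`: `(∀ k, ι(v_k) y = 1) ↔ (∀ a ∈ 𝔭, ι(a) y = 1)` — the `𝔭`-torsion condition is checked on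
generators. [cite: MilneCM2006, §7] -/
theorem forall_comp_i_eq_one_iff_of_span_eq {κ : Type*} (v : κ → O) {𝔭 : Ideal O} (h𝔭 : Ideal.span (Set.range v) = 𝔭)
    {T : Over S} (y : T ⟶ A.X) : (∀ k, y ≫ act.i (v k) = 1) ↔ ∀ a ∈ 𝔭, y ≫ act.i a = 1 := by
  refine ⟨fun h a ha => comp_i_eq_one_of_mem_span act y (s := Set.range v) ?_ (by rw [h𝔭]; exact ha),
    fun h k => h _ (by rw [← h𝔭]; exact Ideal.subset_span ⟨k, rfl⟩)⟩
  rintro _ ⟨k, rfl⟩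
  exact h k

variable {m : ℕ} (E' : Matrix (Fin m) (Fin m) O) (hE' : E' * E' = E') (P : Matrix (Fin m) (Fin 1) O)

/-- **The kernel of `ψ_P` on points, coordinate form**: `y ≫ ψ_P = 1 ↔ ∀ k, y ≫ ι(P_k) = 1`. [cite: Conrad2004GrossZagier, §7 (Thm. 7.5)] -/
theorem comp_serreTranslate_eq_one_iff (hP : E' * P = P) {T : Over S} (y : T ⟶ A.X) :
    y ≫ serreTranslate act E' hE' P = 1 ↔ ∀ k, y ≫ act.i (P k 0) = 1 := by
  rw [eq_one_iff_serreHomEquiv]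
  simp only [serreHomEquiv_comp_serreTranslate act E' hE' P hP]

/-- **`Ker ψ_P = A[𝔭]` ON POINTS**: if the coordinates of `P` generate the ideal `𝔭` (model case: `𝔟 ≅ 𝔭⁻¹`, `P ↔ 1`, `𝔭` invertible),
then for every `S`-scheme `T` and every `y ∈ A(T)`: `y ≫ ψ_P = 1 ↔ ∀ a ∈ 𝔭, ι(a) y = 1`.
[cite: Conrad2004GrossZagier, §7 (Thm. 7.5)] [cite: MilneCM2006, §7] -/
theorem comp_serreTranslate_eq_one_iff_forall_mem (hP : E' * P = P) {𝔭 : Ideal O}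
    (h𝔭 : Ideal.span (Set.range fun k => P k 0) = 𝔭) {T : Over S} (y : T ⟶ A.X) :
    y ≫ serreTranslate act E' hE' P = 1 ↔ ∀ a ∈ 𝔭, y ≫ act.i a = 1 := by
  rw [comp_serreTranslate_eq_one_iff act E' hE' P hP, forall_comp_i_eq_one_iff_of_span_eq act (fun k => P k 0) h𝔭]

/-- The «KILL» direction in the shape consumed by descent (★ `existsUnique_comp_eq_of_forall_comp_eq_one`): a homomorphism `φ` out of `A`
killing the `𝔭`-torsion on points kills `Ker ψ_P`. [cite: MumfordAV1970, §7 Thm. 4 (p. 72)] -/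
theorem comp_eq_one_of_comp_serreTranslate_eq_one (hP : E' * P = P) {𝔭 : Ideal O}
    (h𝔭 : Ideal.span (Set.range fun k => P k 0) = 𝔭) {B : Over S} [GrpObj B] (φ : A.X ⟶ B)
    (hφ : ∀ ⦃T : Over S⦄ (t : T ⟶ A.X), (∀ a ∈ 𝔭, t ≫ act.i a = 1) → t ≫ φ = 1)
    ⦃T : Over S⦄ (t : T ⟶ A.X) (ht : t ≫ serreTranslate act E' hE' P = 1) : t ≫ φ = 1 :=
  hφ t ((comp_serreTranslate_eq_one_iff_forall_mem act E' hE' P hP h𝔭 t).mp ht)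

/-- Conversely `ψ_P` kills the `𝔭`-torsion: `(∀ a ∈ 𝔭, ι(a) t = 1) → t ≫ ψ_P = 1`. [cite: MilneCM2006, §7] -/
theorem comp_serreTranslate_eq_one_of_forall_mem (hP : E' * P = P) {𝔭 : Ideal O}
    (h𝔭 : Ideal.span (Set.range fun k => P k 0) = 𝔭) ⦃T : Over S⦄ (t : T ⟶ A.X) (ht : ∀ a ∈ 𝔭, t ≫ act.i a = 1) :
    t ≫ serreTranslate act E' hE' P = 1 :=
  (comp_serreTranslate_eq_one_iff_forall_mem act E' hE' P hP h𝔭 t).mpr ht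

end Kernel

/-! ## §3 With a quasi-inverse up to `N ≠ 0`, `ψ_P` is finite, flat and surjective: `A ⊗_𝒪 𝔭⁻¹` is the quotient `A ⁄ A[𝔭]` -/

section Isogeny

variable {m : ℕ} (E' : Matrix (Fin m) (Fin m) O) (hE' : E' * E' = E') (P : Matrix (Fin m) (Fin 1) O) (Q : Matrix (Fin 1) (Fin m) O)
  {N : ℕ}

/-- **`ψ_P` is FINITE** when `P` has a quasi-inverse row `Q` (`QE′ = Q`, `QP = N·1`, `PQ = N·E′`, `N ≠ 0`; model case: multiplication by an
integer `N ∈ 𝔭` maps `𝔭⁻¹` back to `𝒪`). [cite: Conrad2004GrossZagier, §7 (Thm. 7.5)] [cite: GortzWedhorn2023, Cor. 27.177 (1)] -/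
theorem isFinite_serreTranslate_left (hN : N ≠ 0) (hP : E' * P = P) (hQ : Q * E' = Q)
    (hQP : Q * P = Matrix.scalar (Fin 1) (N : O)) (hPQ : P * Q = Matrix.scalar (Fin m) (N : O) * E') :
    IsFinite (serreTranslate act E' hE' P).left := by
  haveI := isFinite_serrePresentationHom_left act (1 : Matrix (Fin 1) (Fin 1) O) one_mul_one_fin_one E' hE' P Q hN
    (by rw [Matrix.mul_one]; exact hP) (by rw [Matrix.one_mul]; exact hQ.symm) (by rw [Matrix.mul_one]; exact hQP) hPQ
  haveI : IsIso (serreTensorOneIso act).inv.left := isIso_left_of_isIso _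
  rw [serreTranslate, Over.comp_left]
  infer_instance

/-- **`ψ_P` is FLAT** (same hypotheses). [cite: Conrad2004GrossZagier, §7 (Thm. 7.5)] [cite: GortzWedhorn2023, Cor. 27.177 (1)] -/
theorem flat_serreTranslate_left (hN : N ≠ 0) (hP : E' * P = P) (hQ : Q * E' = Q)
    (hQP : Q * P = Matrix.scalar (Fin 1) (N : O)) (hPQ : P * Q = Matrix.scalar (Fin m) (N : O) * E') :
    Flat (serreTranslate act E' hE' P).left := by
  haveI := flat_serrePresentationHom_left act (1 : Matrix (Fin 1) (Fin 1) O) one_mul_one_fin_one E' hE' P Q hN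
    (by rw [Matrix.mul_one]; exact hP) (by rw [Matrix.one_mul]; exact hQ.symm) (by rw [Matrix.mul_one]; exact hQP) hPQ
  haveI : IsIso (serreTensorOneIso act).inv.left := isIso_left_of_isIso _
  rw [serreTranslate, Over.comp_left]
  infer_instance

/-- **`ψ_P` is SURJECTIVE** (same hypotheses) — so `ψ_P : A ⟶ A ⊗_𝒪 𝔟` is an fppf epimorphism with kernel `A[𝔭]`: «`A ⊗_𝒪 𝔭⁻¹ = A ⁄ A[𝔭]`».
[cite: Conrad2004GrossZagier, §7 (Thm. 7.5)] [cite: MilneCM2006, §7] -/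
theorem surjective_serreTranslate_left (hN : N ≠ 0) (hP : E' * P = P) (hQ : Q * E' = Q)
    (hQP : Q * P = Matrix.scalar (Fin 1) (N : O)) (hPQ : P * Q = Matrix.scalar (Fin m) (N : O) * E') :
    Surjective (serreTranslate act E' hE' P).left := by
  haveI := surjective_serrePresentationHom_left act (1 : Matrix (Fin 1) (Fin 1) O) one_mul_one_fin_one E' hE' P Q hN
    (by rw [Matrix.mul_one]; exact hP) (by rw [Matrix.one_mul]; exact hQ.symm) (by rw [Matrix.mul_one]; exact hQP) hPQ
  haveI : IsIso (serreTensorOneIso act).inv.left := isIso_left_of_isIso _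
  rw [serreTranslate, Over.comp_left]
  infer_instance

end Isogeny

/-! ## §4 Principal ideals: `ψ_{(a)}` is multiplication by `a` -/

section Principal

/-- The entries of the `1 × 1` matrix `a • 1` are `a`. [cite: Kottwitz1992, §5 (p. 390)] -/
theorem smul_one_fin_one_apply (a : O) (k l : Fin 1) : (a • (1 : Matrix (Fin 1) (Fin 1) O)) k l = a := by
  rw [Fin.fin_one_eq_zero k, Fin.fin_one_eq_zero l, Matrix.smul_apply, Matrix.one_apply_eq, smul_eq_mul, mul_one]

/-- **Translation by a principal ideal is multiplication**: for the presentation `𝒪 = 1·𝒪¹` and the element `P = (a)`,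
`ψ_{(a)} = ι(a) ≫ (A ≅ A ⊗_𝒪 𝒪)⁻¹`. [cite: Conrad2004GrossZagier, §7] [cite: MilneCM2006, §7] -/
theorem serreTranslate_smul_one (a : O) :
    serreTranslate act (1 : Matrix (Fin 1) (Fin 1) O) one_mul_one_fin_one (a • (1 : Matrix (Fin 1) (Fin 1) O)) =
      act.i a ≫ (serreTensorOneIso act).inv := by
  rw [serreTranslate, serrePresentationHom_smul_self, Iso.eq_comp_inv, Category.assoc, serreTensorOneIso_equivariant,
    Iso.inv_hom_id_assoc]

/-- … and its kernel is the `a`-torsion: `y ≫ ψ_{(a)} = 1 ↔ ι(a) y = 1`. [cite: MilneCM2006, §7] -/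
theorem comp_serreTranslate_smul_one_eq_one_iff (a : O) {T : Over S} (y : T ⟶ A.X) :
    y ≫ serreTranslate act (1 : Matrix (Fin 1) (Fin 1) O) one_mul_one_fin_one (a • (1 : Matrix (Fin 1) (Fin 1) O)) = 1 ↔
      y ≫ act.i a = 1 := by
  rw [comp_serreTranslate_eq_one_iff act 1 one_mul_one_fin_one _ (by rw [Matrix.mul_smul, Matrix.mul_one])]
  simp only [smul_one_fin_one_apply]
  exact ⟨fun h => h 0, fun h _ => h⟩

end Principal

end AbelianSchemeOver

end Literature.AlgebraicGeometry.AbelianSchemes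

end
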